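import Mathlib.Tactic.Module
import Literature.Topology.Immersions.HolonomicApproximationGluing
import HarnessLib

/-!
# Holonomic approximation over a segment (Eliashberg–Mishachev, Thm. 1.3.1 for `k = 1`)

Topic `Literature/Topology/Immersions`; the analytic heart of the Gromov–Eliashberg–Mishachev
route to Phillips' submersion theorem for handles of index `1`. We prove the **holonomic
approximation theorem over a one-dimensional cube** (Eliashberg–Mishachev 2001, Thm. 1.3.1
with `k = 1 < n + 2`, `r = 1`, in the relative form): let `(F₀, F₁)` be a continuous section
of `J¹(ℝⁿ⁺², F)` — a continuous map `F₀` and a continuous field `F₁` of continuous linear maps —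
which is holonomic near the two end points `c(0) = 0`, `c(1) = e₀` of the core segment
`c([0, 1])`, i.e. equal there to the `1`-jet of a `C^∞` map `φ₀`. Then for all `ε, δ > 0`
there are a wiggle `φ_N` of amplitude `≤ δ` vanishing near the ends (so that the shear
`h = shear φ_N 0 1` is a `C^∞` diffeomorphism of `ℝⁿ⁺²`, `δ`-close to the identity and equal to it
near the end points), an open set `Ω ⊇ h(c([0, 1]))` and a `C^∞` map `g` — a holonomic section
`(g, Dg)` — with `‖g - F₀‖ < ε`, `‖Dg - F₁‖ < ε` on `Ω` and `g = φ₀` near the two ends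
(`{x₀ < r} ∪ {x₀ > 1 - r}`).

Proof. The base of EM's induction ("any section is holonomic over a point"): the affine
Taylor sections `x ↦ F₀(c(s)) + F₁(c(s))(x - c(s))` at the core points, blended near the ends
with the given `φ₀` by a cut-off `ρ(s)` (so that the family is exactly `φ₀` for `s ≤ η'` and
`s ≥ 1 - η'`), form a gluing family (`IsGluingFamily`,
`HolonomicApproximationGluing.lean`): jointly continuous with its derivative, `ε/4`-close to
`(F₀, F₁)` on small balls (`taylorAffine_approx`, and `φ₀ = F₀`, `Dφ₀ = F₁` near the ends);
the gluing theorem `exists_glue_family_along_wiggle` does the rest.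

* `Literature.Topology.Immersions.endBlend η'` — the cut-off `ρ`, `= 1` on `(-∞, η'] ∪ [1 - η', ∞)`,
  `= 0` on `[2η', 1 - 2η']`.
* `Literature.Topology.Immersions.taylorFamily F₀ F₁ φ₀ η'` — the blended Taylor family.
* `Literature.Topology.Immersions.isGluingFamily_taylorFamily` — it is a gluing family.
* `Literature.Topology.Immersions.holonomicApproximation_segment` — the theorem.

## References

* Y. Eliashberg, N. Mishachev, *Holonomic approximation and Gromov's h-principle*,
  arXiv:math/0101196 (2001), Thm. 1.2.1, Thm. 1.3.1, Lemma 1.3.2. [EliashbergMishachev2001]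
* Y. Eliashberg, N. Mishachev, *Introduction to the h-principle*, GSM 48, AMS (2002), Ch. 3,
  Thm. 3.1.1. [EliashbergMishachev2002]
-/

open Set Function Filter Metric Real
open scoped Topology ContDiff

noncomputable section

namespace Literature.Topology.Immersions

open Literature.Topology.FourManifolds (smoothStep smoothStep_of_le smoothStep_of_ge
  smoothStep_mem_Icc contDiff_smoothStep)

variable {n : ℕ} {F : Type*} [NormedAddCommGroup F] [NormedSpace ℝ F]

/-- Local notation: the model space `ℝⁿ⁺²`. -/
local notation "𝔼₂" => EuclideanSpace ℝ (Fin (n + 2))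

/-! ### The end cut-off and the blended Taylor family -/

/-- The end cut-off `ρ(s) = 1 - smoothStep η' 2η' (s) · smoothStep η' 2η' (1 - s)`: equal to `1`
for `s ≤ η'` and for `s ≥ 1 - η'`, to `0` on `[2η', 1 - 2η']`, `[0,1]`-valued, `C^∞`. [folklore] -/
def endBlend (η' s : ℝ) : ℝ :=
  1 - smoothStep η' (2 * η') s * smoothStep η' (2 * η') (1 - s)

/-- Unfolding lemma for `endBlend`. [folklore] -/
theorem endBlend_apply (η' s : ℝ) :
    endBlend η' s = 1 - smoothStep η' (2 * η') s * smoothStep η' (2 * η') (1 - s) :=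
  rfl

/-- `ρ` is `C^∞`. [folklore] -/
theorem contDiff_endBlend (η' : ℝ) : ContDiff ℝ ∞ (endBlend η') := by
  unfold endBlend
  exact contDiff_const.sub ((contDiff_smoothStep _ _).mul
    ((contDiff_smoothStep _ _).comp (contDiff_const.sub contDiff_id)))

/-- `ρ` is continuous. [folklore] -/
theorem continuous_endBlend (η' : ℝ) : Continuous (endBlend η') :=
  (contDiff_endBlend η').continuous

/-- `0 ≤ ρ ≤ 1`. [folklore] -/
theorem endBlend_mem_Icc (η' s : ℝ) : endBlend η' s ∈ Icc (0 : ℝ) 1 := by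
  have h1 := smoothStep_mem_Icc η' (2 * η') s
  have h2 := smoothStep_mem_Icc η' (2 * η') (1 - s)
  rw [endBlend_apply]
  constructor
  · have : smoothStep η' (2 * η') s * smoothStep η' (2 * η') (1 - s) ≤ 1 :=
      mul_le_one₀ h1.2 h2.1 h2.2
    linarith
  · have : 0 ≤ smoothStep η' (2 * η') s * smoothStep η' (2 * η') (1 - s) := mul_nonneg h1.1 h2.1
    linarith

/-- `ρ(s) = 1` for `s ≤ η'` (`0 < η'`). [folklore] -/
theorem endBlend_of_le {η' s : ℝ} (hη' : 0 < η') (hs : s ≤ η') : endBlend η' s = 1 := by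
  rw [endBlend_apply, smoothStep_of_le (by linarith) hs, zero_mul, sub_zero]

/-- `ρ(s) = 1` for `1 - η' ≤ s` (`0 < η'`). [folklore] -/
theorem endBlend_of_ge {η' s : ℝ} (hη' : 0 < η') (hs : 1 - η' ≤ s) : endBlend η' s = 1 := by
  rw [endBlend_apply, smoothStep_of_le (a := η') (b := 2 * η') (x := 1 - s) (by linarith)
    (by linarith), mul_zero, sub_zero]

/-- `ρ(s) = 0` for `2η' ≤ s ≤ 1 - 2η'` (`0 < η'`). [folklore] -/
theorem endBlend_of_mem {η' s : ℝ} (hη' : 0 < η') (h1 : 2 * η' ≤ s) (h2 : s ≤ 1 - 2 * η') :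
    endBlend η' s = 0 := by
  rw [endBlend_apply, smoothStep_of_ge (by linarith) h1,
    smoothStep_of_ge (a := η') (b := 2 * η') (x := 1 - s) (by linarith) (by linarith), mul_one,
    sub_self]

/-- If `ρ(s) ≠ 0` then `s < 2η'` or `1 - 2η' < s`. [folklore] -/
theorem endBlend_ne_zero {η' s : ℝ} (hη' : 0 < η') (h : endBlend η' s ≠ 0) :
    s < 2 * η' ∨ 1 - 2 * η' < s := by
  by_contra hcon
  simp only [not_or, not_lt] at hcon
  exact h (endBlend_of_mem hη' hcon.1 hcon.2)

/-- The **blended Taylor family** `f_s = ρ(s) φ₀ + (1 - ρ(s)) T_{c(s)}`, `T_c` the affine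
Taylor section of `(F₀, F₁)` at `c` (EM 2001, proof of Thm. 1.3.1, base of the induction:
"any section is holonomic over a point", adjusted to be exactly the given holonomic `φ₀` for
parameters near the ends, cf. proof of Lemma 1.3.2: "we can further adjust … to have
`F_{y,t} = F` for `(y, t) ∈ ∂(I^{k-l} × I)`"). [cite: EliashbergMishachev2001, Thm. 1.3.1] -/
def taylorFamily (F₀ : 𝔼₂ → F) (F₁ : 𝔼₂ → 𝔼₂ →L[ℝ] F) (φ₀ : 𝔼₂ → F) (η' : ℝ) (s : ℝ) (x : 𝔼₂) : F :=
  endBlend η' s • φ₀ x + (1 - endBlend η' s) • taylorAffine F₀ F₁ (coreLine n s) x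

/-- Unfolding lemma for `taylorFamily`. [folklore] -/
theorem taylorFamily_apply (F₀ : 𝔼₂ → F) (F₁ : 𝔼₂ → 𝔼₂ →L[ℝ] F) (φ₀ : 𝔼₂ → F) (η' s : ℝ) (x : 𝔼₂) :
    taylorFamily F₀ F₁ φ₀ η' s x =
      endBlend η' s • φ₀ x + (1 - endBlend η' s) • taylorAffine F₀ F₁ (coreLine n s) x :=
  rfl

section Family

-- (the local notation `𝔼₂` must not be used inside `variable` binders: it captures `n`)
variable {F₀ : EuclideanSpace ℝ (Fin (n + 2)) → F}
  {F₁ : EuclideanSpace ℝ (Fin (n + 2)) → EuclideanSpace ℝ (Fin (n + 2)) →L[ℝ] F}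
  {φ₀ : EuclideanSpace ℝ (Fin (n + 2)) → F} {η' : ℝ}

/-- Where `ρ = 1` the family is `φ₀`. [folklore] -/
theorem taylorFamily_of_endBlend_eq_one {s : ℝ} (h : endBlend η' s = 1) :
    taylorFamily F₀ F₁ φ₀ η' s = φ₀ := by
  funext x
  simp [taylorFamily_apply, h]

/-- Each member of the family is `C^∞` when `φ₀` is. [folklore] -/
theorem contDiff_taylorFamily (hφ₀ : ContDiff ℝ ∞ φ₀) (s : ℝ) :
    ContDiff ℝ ∞ (taylorFamily F₀ F₁ φ₀ η' s) := by
  unfold taylorFamily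
  exact (contDiff_const.smul hφ₀).add (contDiff_const.smul (contDiff_taylorAffine _ _ _))

/-- **Derivative of the family**: `D(f_s)_x = ρ(s) Dφ₀(x) + (1 - ρ(s)) F₁(c(s))`. [folklore] -/
theorem hasFDerivAt_taylorFamily (hφ₀ : ContDiff ℝ ∞ φ₀) (s : ℝ) (x : 𝔼₂) :
    HasFDerivAt (taylorFamily F₀ F₁ φ₀ η' s)
      (endBlend η' s • fderiv ℝ φ₀ x + (1 - endBlend η' s) • F₁ (coreLine n s)) x := by
  have h1 : HasFDerivAt φ₀ (fderiv ℝ φ₀ x) x := (hφ₀.differentiable (by simp) x).hasFDerivAt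
  have h2 := hasFDerivAt_taylorAffine F₀ F₁ (coreLine n s) x
  exact (h1.const_smul _).add (h2.const_smul _)

/-- The derivative of the family, as a formula for `fderiv`. [folklore] -/
theorem fderiv_taylorFamily (hφ₀ : ContDiff ℝ ∞ φ₀) (s : ℝ) (x : 𝔼₂) :
    fderiv ℝ (taylorFamily F₀ F₁ φ₀ η' s) x =
      endBlend η' s • fderiv ℝ φ₀ x + (1 - endBlend η' s) • F₁ (coreLine n s) :=
  (hasFDerivAt_taylorFamily hφ₀ s x).fderiv

/-- The family is jointly continuous. [folklore] -/
theorem continuous_taylorFamily (h₀ : Continuous F₀) (h₁ : Continuous F₁) (hφ₀ : Continuous φ₀) :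
    Continuous fun q : ℝ × 𝔼₂ => taylorFamily F₀ F₁ φ₀ η' q.1 q.2 := by
  have hρ : Continuous fun q : ℝ × 𝔼₂ => endBlend η' q.1 := (continuous_endBlend η').comp continuous_fst
  have hT : Continuous fun q : ℝ × 𝔼₂ => taylorAffine F₀ F₁ (coreLine n q.1) q.2 := by
    have hc : ContinuousOn (fun q : 𝔼₂ × 𝔼₂ => taylorAffine F₀ F₁ q.1 q.2) (univ ×ˢ univ) :=
      continuousOn_taylorAffine h₀.continuousOn h₁.continuousOn
    rw [univ_prod_univ, continuousOn_univ] at hc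
    exact hc.comp ((continuous_coreLine.comp continuous_fst).prodMk continuous_snd)
  unfold taylorFamily
  exact (hρ.smul (hφ₀.comp continuous_snd)).add ((continuous_const.sub hρ).smul hT)

/-- The derivative of the family is jointly continuous (`φ₀` of class `C¹`). [folklore] -/
theorem continuous_fderiv_taylorFamily (h₁ : Continuous F₁) (hφ₀ : ContDiff ℝ ∞ φ₀) :
    Continuous fun q : ℝ × 𝔼₂ => fderiv ℝ (taylorFamily F₀ F₁ φ₀ η' q.1) q.2 := by
  have hρ : Continuous fun q : ℝ × 𝔼₂ => endBlend η' q.1 := (continuous_endBlend η').comp continuous_fst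
  have hD : Continuous (fderiv ℝ φ₀) := hφ₀.continuous_fderiv (by simp)
  have : (fun q : ℝ × 𝔼₂ => fderiv ℝ (taylorFamily F₀ F₁ φ₀ η' q.1) q.2) = fun q =>
      endBlend η' q.1 • fderiv ℝ φ₀ q.2 + (1 - endBlend η' q.1) • F₁ (coreLine n q.1) := by
    funext q
    exact fderiv_taylorFamily hφ₀ q.1 q.2
  rw [this]
  exact (hρ.smul (hD.comp continuous_snd)).add
    ((continuous_const.sub hρ).smul (h₁.comp (continuous_coreLine.comp continuous_fst)))

end Family

/-! ### The blended Taylor family is a gluing family -/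

/-- **The blended Taylor family is a gluing family** (base of EM's induction). Let `F₀`, `F₁`
be continuous, `φ₀` a `C^∞` map with `φ₀ = F₀`, `Dφ₀ = F₁` on an open set `O` containing the
end points `c(0)`, `c(1)`, and `ε > 0`. Then for suitable `d > 0` (from `taylorAffine_approx`
and the size of `O` at the end points) and `η' > 0`, the family `taylorFamily F₀ F₁ φ₀ η'` is a
gluing family for `(F₀, F₁)` at precision `ε/4` on `d`-balls, constant for `s ≤ η'`,
`s ≥ 1 - η'`. [cite: EliashbergMishachev2001, Thm. 1.3.1] -/
theorem isGluingFamily_taylorFamily {F₀ : 𝔼₂ → F} {F₁ : 𝔼₂ → 𝔼₂ →L[ℝ] F} (h₀ : Continuous F₀)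
    (h₁ : Continuous F₁) {φ₀ : 𝔼₂ → F} (hφ₀ : ContDiff ℝ ∞ φ₀) {O : Set 𝔼₂} (hO : IsOpen O)
    (hO0 : coreLine n 0 ∈ O) (hO1 : coreLine n 1 ∈ O)
    (hhol : ∀ x ∈ O, φ₀ x = F₀ x ∧ fderiv ℝ φ₀ x = F₁ x) {ε : ℝ} (hε : 0 < ε) :
    ∃ d η' : ℝ, IsGluingFamily (taylorFamily F₀ F₁ φ₀ η') F₀ F₁ ε d η' := by
  -- room at the end points
  obtain ⟨r₀, hr₀, hr₀O⟩ : ∃ r₀ > 0, ball (coreLine n 0) r₀ ⊆ O ∧ ball (coreLine n 1) r₀ ⊆ O := by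
    obtain ⟨r, hr, hrO⟩ := Metric.isOpen_iff.1 hO _ hO0
    obtain ⟨r', hr', hr'O⟩ := Metric.isOpen_iff.1 hO _ hO1
    exact ⟨min r r', lt_min hr hr', (ball_subset_ball (min_le_left _ _)).trans hrO,
      (ball_subset_ball (min_le_right _ _)).trans hr'O⟩
  -- the Taylor scale on the compact core
  have hK : IsCompact (coreLine n '' Icc (0 : ℝ) 1) := isCompact_Icc.image continuous_coreLine
  obtain ⟨dT, hdT, -, hT⟩ := taylorAffine_approx (F₁ := F₁) isOpen_univ hK (subset_univ _)
    h₀.continuousOn h₁.continuousOn (ε := ε / 4) (by positivity)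
  -- the scales
  set d : ℝ := min dT (r₀ / 2) with hd
  have hdpos : 0 < d := lt_min hdT (by positivity)
  set η' : ℝ := r₀ / 4 with hη'
  have hη'pos : 0 < η' := by positivity
  refine ⟨d, η', ⟨contDiff_taylorFamily hφ₀, continuous_taylorFamily h₀ h₁ hφ₀.continuous,
    continuous_fderiv_taylorFamily h₁ hφ₀, hdpos, ?_, hη'pos, ?_, ?_⟩⟩
  · -- the approximation property
    intro s hs x hx
    have hxT : x ∈ ball (coreLine n s) dT := ball_subset_ball (min_le_left _ _) hx
    obtain ⟨hT0, hT1⟩ := hT (coreLine n s) (mem_image_of_mem _ hs) x hxT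
    have hρ := endBlend_mem_Icc η' s
    -- where the blend is active, `φ₀ = F₀` and `Dφ₀ = F₁`
    have hend : endBlend η' s ≠ 0 → φ₀ x = F₀ x ∧ fderiv ℝ φ₀ x = F₁ x := by
      intro hne
      apply hhol
      have hxr : dist x (coreLine n s) < r₀ / 2 := (mem_ball.1 hx).trans_le (min_le_right _ _)
      rcases endBlend_ne_zero hη'pos hne with hs' | hs'
      · refine hr₀O.1 (mem_ball.2 ?_)
        calc dist x (coreLine n 0) ≤ dist x (coreLine n s) + dist (coreLine n s) (coreLine n 0) :=
              dist_triangle _ _ _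
          _ < r₀ / 2 + 2 * η' := by
              rw [dist_eq_norm (coreLine n s), norm_coreLine_sub, sub_zero, abs_of_nonneg hs.1]
              linarith
          _ = r₀ := by rw [hη']; ring
      · refine hr₀O.2 (mem_ball.2 ?_)
        calc dist x (coreLine n 1) ≤ dist x (coreLine n s) + dist (coreLine n s) (coreLine n 1) :=
              dist_triangle _ _ _
          _ < r₀ / 2 + 2 * η' := by
              rw [dist_eq_norm (coreLine n s), norm_coreLine_sub, abs_sub_comm,
                abs_of_nonneg (by linarith [hs.2])]
              linarith
          _ = r₀ := by rw [hη']; ring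
    constructor
    · -- values
      have hsplit : taylorFamily F₀ F₁ φ₀ η' s x - F₀ x =
          endBlend η' s • (φ₀ x - F₀ x) +
            (1 - endBlend η' s) • (taylorAffine F₀ F₁ (coreLine n s) x - F₀ x) := by
        rw [taylorFamily_apply]
        module
      rw [hsplit]
      by_cases hρ0 : endBlend η' s = 0
      · rw [hρ0, zero_smul, zero_add, sub_zero, one_smul]
        exact hT0
      · rw [(hend hρ0).1, sub_self, smul_zero, zero_add, norm_smul,
          Real.norm_of_nonneg (by linarith [hρ.2])]
        calc (1 - endBlend η' s) * ‖taylorAffine F₀ F₁ (coreLine n s) x - F₀ x‖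
            ≤ 1 * ‖taylorAffine F₀ F₁ (coreLine n s) x - F₀ x‖ := by
              gcongr; linarith [hρ.1]
          _ < ε / 4 := by rw [one_mul]; exact hT0
    · -- derivatives
      rw [fderiv_taylorFamily hφ₀]
      have hsplit : endBlend η' s • fderiv ℝ φ₀ x + (1 - endBlend η' s) • F₁ (coreLine n s) - F₁ x =
          endBlend η' s • (fderiv ℝ φ₀ x - F₁ x) +
            (1 - endBlend η' s) • (F₁ (coreLine n s) - F₁ x) := by
        module
      rw [hsplit]
      by_cases hρ0 : endBlend η' s = 0
      · rw [hρ0, zero_smul, zero_add, sub_zero, one_smul]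
        exact hT1
      · rw [(hend hρ0).2, sub_self, smul_zero, zero_add, norm_smul,
          Real.norm_of_nonneg (by linarith [hρ.2])]
        calc (1 - endBlend η' s) * ‖F₁ (coreLine n s) - F₁ x‖
            ≤ 1 * ‖F₁ (coreLine n s) - F₁ x‖ := by gcongr; linarith [hρ.1]
          _ < ε / 4 := by rw [one_mul]; exact hT1
  · -- constant near the left end
    intro s hs
    rw [taylorFamily_of_endBlend_eq_one (endBlend_of_le hη'pos hs),
      taylorFamily_of_endBlend_eq_one (endBlend_of_le hη'pos hη'pos.le)]
  · -- constant near the right end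
    intro s hs
    rw [taylorFamily_of_endBlend_eq_one (endBlend_of_ge hη'pos hs),
      taylorFamily_of_endBlend_eq_one (endBlend_of_ge hη'pos (by linarith))]

/-! ### The theorem -/

/-- **Holonomic approximation over a segment** (Eliashberg–Mishachev 2001, Thm. 1.3.1 for the
one-dimensional cube `[0, 1] × 0 ⊂ ℝⁿ⁺²`, first-order jets, relative to the end points; the special
case from which the `h`-principle over `1`-handles follows). Let `F₀ : ℝⁿ⁺² → F` and
`F₁ : ℝⁿ⁺² → L(ℝⁿ⁺², F)` be continuous (a section of `J¹`), holonomic near the end points of the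
core segment: `φ₀` is `C^∞` with `φ₀ = F₀`, `Dφ₀ = F₁` on an open set containing `c(0)`, `c(1)`.
Then for every `ε > 0`, `δ > 0` there are `N`, an amplitude `0 < δ₁ ≤ δ` — defining the wiggle
`φ_N = wiggle N δ₁` (`|φ_N| ≤ δ₁`, `φ_N = 0` near `t ≤ 0` and `t ≥ 1`) and the shear
`h = shear φ_N 0 1` (a `C^∞` diffeomorphism `x ↦ x + φ_N(x₀) e₁`, `‖h - id‖ ≤ δ`, `h = id` near the
end points) — an open set `Ω` containing the wiggled core `h(c([0, 1]))` and a `C^∞` map `g` with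
`‖g - F₀‖ < ε` and `‖Dg - F₁‖ < ε` on `Ω`, and `g = φ₀` on `{x₀ < r} ∪ {x₀ > 1 - r}` for some
`r > 0`. [cite: EliashbergMishachev2001, Thm. 1.3.1] -/
theorem holonomicApproximation_segment {F₀ : 𝔼₂ → F} {F₁ : 𝔼₂ → 𝔼₂ →L[ℝ] F} (h₀ : Continuous F₀)
    (h₁ : Continuous F₁) {φ₀ : 𝔼₂ → F} (hφ₀ : ContDiff ℝ ∞ φ₀) {O : Set 𝔼₂} (hO : IsOpen O)
    (hO0 : coreLine n 0 ∈ O) (hO1 : coreLine n 1 ∈ O)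
    (hhol : ∀ x ∈ O, φ₀ x = F₀ x ∧ fderiv ℝ φ₀ x = F₁ x) {ε δ : ℝ} (hε : 0 < ε) (hδ : 0 < δ) :
    ∃ (N : ℕ) (δ₁ : ℝ), 0 < N ∧ 0 < δ₁ ∧ δ₁ ≤ δ ∧
      ∃ (g : 𝔼₂ → F) (Ω : Set 𝔼₂), ContDiff ℝ ∞ g ∧ IsOpen Ω ∧
        (∀ s ∈ Icc (0 : ℝ) 1, shear (wiggle N δ₁) 0 1 (coreLine n s) ∈ Ω) ∧
        (∀ x ∈ Ω, ‖g x - F₀ x‖ < ε ∧ ‖fderiv ℝ g x - F₁ x‖ < ε) ∧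
        (∃ r > 0, ∀ x : 𝔼₂, x 0 < r → g x = φ₀ x) ∧
        (∃ r > 0, ∀ x : 𝔼₂, 1 - r < x 0 → g x = φ₀ x) := by
  obtain ⟨d, η', hfam⟩ := isGluingFamily_taylorFamily h₀ h₁ hφ₀ hO hO0 hO1 hhol hε
  obtain ⟨N, δ₁, hN, hδ₁, hδ₁δ, g, Ω, hg, hΩ, hcore, hest, ⟨r, hr, hleft⟩, ⟨r', hr', hright⟩⟩ :=
    exists_glue_family_along_wiggle hε hfam hδ
  have h0 : taylorFamily F₀ F₁ φ₀ η' 0 = φ₀ :=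
    taylorFamily_of_endBlend_eq_one (endBlend_of_le hfam.η_pos hfam.η_pos.le)
  have h1 : taylorFamily F₀ F₁ φ₀ η' 1 = φ₀ :=
    taylorFamily_of_endBlend_eq_one (endBlend_of_ge hfam.η_pos (by linarith [hfam.η_pos]))
  refine ⟨N, δ₁, hN, hδ₁, hδ₁δ, g, Ω, hg, hΩ, hcore, hest, ⟨r, hr, fun x hx => ?_⟩,
    ⟨r', hr', fun x hx => ?_⟩⟩
  · rw [hleft x hx, h0]
  · rw [hright x hx, h1]

end Literature.Topology.Immersions
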